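import Summits.CriticalPhenomena.SAWScalingLimit.Theses.SAWLoopFugacityFlow
import Summits.CriticalPhenomena.SAWScalingLimit.Theorems.IsingBoundaryRatio.Negative.IsingBoundaryRatioNesting
import Summits.CriticalPhenomena.SAWScalingLimit.Theorems.IsingBoundaryRatio.Negative.IsingBoundaryRatioNormalisation
import Summits.CriticalPhenomena.SAWScalingLimit.Theorems.SAWLoopFugacityFlowIsingBoundaryRatioRestrictionMapAtZero
import Summits.CriticalPhenomena.SAWScalingLimit.Theorems.SAWLoopFugacityFlowIsingBoundaryRatioRestrictionMapAtInfty
import Summits.CriticalPhenomena.SAWScalingLimit.Theorems.SAWLoopFugacityFlowIsingBoundaryRatioBoundaryFusion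
import Summits.CriticalPhenomena.SAWScalingLimit.Theorems.SAWLoopFugacityFlowIsingBoundaryRatioBulkFreeRatio
import Literature.Probability.LatticeModels.PlanarIsingOnePointProofs

/-!
# Line `fk-anchor-transfer` — skeleton for the crux `IsingBoundaryRatio`, VARIANT c1 (minimal residual)

THIS FILE (`Lines/fk_anchor_transfer_c1.lean`) is the cycle-c1 lead's variant of the line's skeleton
(`prover-line-stmt-CriticalPhenomena-10650-c1-0`), kept beside the registered skeleton
`Lines/fk_anchor_transfer.lean` of the concurrent lead-1 (`prover-line-stmt-CriticalPhenomena-10650-1`,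
rev 4, FK decomposition of anchor locality into five stubs). It records the MINIMAL-RESIDUAL composition:
stubs `stub_anchorTransfer` (= `AnchorTransfer`, open) and `stub_chiTwoPointFreeJordan` (named fact X),
everything else landed, plus the PROVED converse `anchorTransfer_of_normalForm` — landed separately as the
registered sub-goal `Theorems.IsingBoundaryRatio.isingBoundaryRatio_iff_anchorTransfer` (p100741): modulo X
the crux is EQUIVALENT to `AnchorTransfer`. Any proof of lead-1's `stub_anchorLocality` closes this variant
too (`stub_anchorTransfer_of_anchorLocality`). The registered stub set on the item is lead-1's; this file
is not re-registered so as not to disturb their `--supports` landings.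

(stmt-CriticalPhenomena-10650, route `SAWLoopFugacityFlow`, decl
`Summit.CriticalPhenomena.SAWScalingLimit.Theses.SAWLoopFugacityFlow.IsingBoundaryRatio`; crux-plan round 1,
planner `planner-cruxplan-stmt-CriticalPhenomena-10650-fk-anchor-transfer-0`; idea card
`Cruxes/IsingBoundaryRatio/Ideas/fk-anchor-transfer.md`, triage r1: 3 × pass).

MOVE THE ANCHORS INLAND. The crux's ratio `⟨σ_{a_δ}σ_{b_δ}⟩^free_{Ω'_δ} / ⟨σ_{a_δ}σ_{b_δ}⟩^free_{Ω_δ}`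
is compared with the same nested ratio for BULK anchors `[z/δ], [w/δ]`, `z, w ∈ D'` close to `a, b`:

* `stub_anchorLocality` (= `AnchorLocality`; L, OPEN, HARDEST — the lever, ONE marked point at a
  time as the triage asked): the double ratio (anchor `x` vs anchor `x'`, both near `D.pt i`, against
  a far spin `y`; `Ω'` over `Ω`) is eventually within `η` of `1` — the boundary-anchor/bulk-anchor
  ratio is blind to the domain beyond `B(D.pt i, ε)` (Edwards–Sokal + arm-origin forgetting for critical
  FK-Ising at a free ROUGH prime end; value-free, no conformal map);
* `stub_bulkFreeRatio` (= `BulkFreeRatio`; L, PRINTED: CHI15 Thm 1.1 free case, crux convention,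
  divided): the bulk nested ratio at fixed interior `z ≠ w` converges to the ratio of CHI's explicit
  free two-point functions `twoPointFreeCHI` of `D'` and `D`;
* `BoundaryFusion` (M, explicit): that continuum ratio tends to `d^{1/2} = Φ'_A(0)^{1/2}` as
  `(z, w) → (a, b)` inside `D'` — RESHAPED by the line lead (cycle 1) into three registered stubs:
  `stub_restrictionMapAtZero` (`Im Φζ/Im ζ → d`, `Φ'ζ → d` at `0`), `stub_restrictionMapAtInfty`
  (the same at `∞`, from the statement at `0` by inversion) and `stub_boundaryFusionCore` (the two
  restriction-map facts ⇒ `BoundaryFusion`: chain rule, `u`-asymptotics, Carathéodory).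

STATE AFTER CYCLE 1 (rev 3, line lead): `stub_restrictionMapAtZero` (p86712),
`stub_restrictionMapAtInfty` (p88223), `stub_boundaryFusionCore` (p87614) are LANDED under
`Theorems/SAWLoopFugacityFlowIsingBoundaryRatio*.lean` and referenced here by name;
`stub_bulkFreeRatio` is LANDED CONDITIONALLY (p91239, `bulkFreeRatio_of_chi`) on the Literature named
fact `chi_twoPoint_free_jordan` (p88667, CHI15 Thm 1.1 free, unproved in tree), carried below as the
`sorry`'d `stub_chiTwoPointFreeJordan` (named fact X — debt queue, not a worker task). Exactly two
`sorry`s remain: `stub_anchorLocality` (unprinted; see `Lines/fk_anchor_transfer_stuck.md`; the Edwards–Sokal form of `T` is landed as `Theorems.IsingBoundaryRatio.stub_T_eq_fkConn`, p92083) and X.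

STATE AFTER CYCLE c1 (rev 4, line lead `prover-line-stmt-CriticalPhenomena-10650-c1-0`): RESHAPED — the
open lattice stub is now the MINIMAL statement the composition consumes, `stub_anchorTransfer`
(= `AnchorTransfer`; registered stubs: `stub_anchorTransfer`, `stub_chiTwoPointFreeJordan`), and the new
PROVED theorem `anchorTransfer_of_normalForm` (with `anchorTransfer_iff_normalForm`,
`anchorTransfer_of_IsingBoundaryRatio`) certifies that modulo the printed fact X this stub is
EQUIVALENT to the crux: the line has no strictly smaller sufficient residual. `AnchorLocality` (rev-3
stub) remains a proved SUFFICIENT entry (`stub_anchorTransfer_of_anchorLocality`).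

PROVED here (no `sorry` outside `stub_anchorTransfer` / `stub_chiTwoPointFreeJordan`): `anchorTransfer_of_anchorLocality` (two-end
transfer in difference form: anchor locality at `a` with far spin `b_δ`, then at `b` with far spin
`[z/δ]`, symmetry of `⟨σσ⟩`, GKS-II sandwich `T_mono`, GKS-I positivity `T_pos_of_reachable`, bulk sites
of a Jordan subdomain eventually in `Ω'_δ` — `eventually_bulk_reachable`), `normalForm_of_transfer` (the
`3η` argument: the product filter `𝓝[D'] a ×ˢ 𝓝[D'] b` is non-trivial, pick `(z, w)` there, then
`BulkFreeRatio` pins the lattice bulk ratio) and the composition `IsingBoundaryRatio_of :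
AnchorLocality → BulkFreeRatio → BoundaryFusion → IsingBoundaryRatio` (hypotheses spelled through the
name-keyed aliases `Registered.stub_*`) BY NAME through the landed equivalence
`Negative.isingBoundaryRatio_iff_normalForm`.

DISPROOF USED (`Cruxes/IsingBoundaryRatio/Disproof.lean`, cdisprove gen 1; landed as
`Theorems/IsingBoundaryRatio/Negative/IsingBoundaryRatio{Lattice,Nesting,Normalisation}.lean`, imported):
`isingBoundaryRatio_false_without_IsRestrictionMap` / `_HasRestrictionDeriv` — the line uses BOTH
hypotheses at `stub_boundaryFusion` (they pin `d`; the other two stubs are `d`-free); the load-bearing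
INNER approximation `IsEndpointApprox D' a b` is used in `anchorTransfer_of_anchorLocality`
(reachability of `a_δ, b_δ` in `Ω'_δ`, `eventually_meshDomain_subset`); the idle hypotheses (outer
approximation, `pt` equalities) are used only for convenience (`normalForm_of_transfer` uses
`D'.pt i = D.pt i` to see `a, b ∈ closure D'`); `crux_diag` / `eventually_ratio_mem_Ioc` /
`limit_le_one`: on the diagonal `D' = D` every stub is consistent (`AnchorLocality`: double ratio
`≡ 1`; `BulkFreeRatio`: ratio `≡ 1 →` `1`; `BoundaryFusion`: `A = ∅`, `d = 1`), and `d^{1/2} ≤ 1`. No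
landed Negative lemma refutes an instance of any stub (they concern dropped normalisations, the
two-sided filter and negative exponents). Negatives index: no refuted statement of the summit concerns
Ising correlation ratios; no stub uses an all-`δ` quantifier (stmt-0772 pattern) — every lattice
statement is along `𝓝[>] 0`.

WORKER HEADER (to restate a registered stub verbatim): the first two imports of this module + `Literature.Probability.LatticeModels.PlanarIsingOnePointProofs`, then
`open scoped Topology` and `open Filter Set Metric Literature.Probability.LatticeModels
Literature.Probability.RandomPlanarGeometry Summit.CriticalPhenomena.SAWScalingLimit.Theorems.IsingBoundaryRatio.Negative`
(`T Ω δ x y` = the landed normal form of the crux's inline free two-point function, `inline_eq_T`).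
-/

noncomputable section

open scoped Classical Topology
open MeasureTheory Filter Set Function Metric
open Literature.Probability.LatticeModels Literature.Probability.RandomPlanarGeometry
open UpperHalfPlane (upperHalfPlaneSet)

namespace Summit.CriticalPhenomena.SAWScalingLimit.Cruxes.IsingBoundaryRatio.FkAnchorTransfer

open Summit.CriticalPhenomena.SAWScalingLimit.Theorems.IsingBoundaryRatio.Negative

/-! ### The statements of the line (named `Prop`s over existing declarations)

`T Ω δ x y = ⟨σ_xσ_y⟩^free_{Ω_δ; β_c, 0}` is the landed normal form of the crux's inline two-point
function (`Theorems/IsingBoundaryRatio/Negative/IsingBoundaryRatioLattice.lean`, `inline_eq_T`). -/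

/-- **Anchor locality at a marked prime end** (the lever; ONE marked point at a time). For the hull
subdomain `D' ⊆ D` agreeing with `D` in the ball `B(D.pt i, ε)`, for every `c > 0` and `η > 0` there
is `r > 0` such that for any two anchor families `x_δ, x'_δ` whose mesh points are eventually in
`B(D.pt i, r)` and any far family `y_δ` eventually at distance `≥ c` from `D.pt i`, all joined in
`Ω'_δ`, the DOUBLE RATIO `[⟨σ_xσ_y⟩_{Ω'}/⟨σ_{x'}σ_y⟩_{Ω'}] / [⟨σ_xσ_y⟩_{Ω}/⟨σ_{x'}σ_y⟩_{Ω}]` is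
eventually within `η` of `1`: the ratio of the two anchors' correlations with a far spin forgets the
domain (and the far spin) beyond `B(D.pt i, ε)`. Mechanism: Edwards–Sokal, then conditionally on the
FK arm from the anchor reaching scale `s ≫ r` the configuration beyond forgets the anchor
(RSW in conformal half-annuli uniformly in boundary conditions — CDH16 —, FKG, domain Markov), while
inside `B(D.pt i, ε)` the graphs `Ω_δ`, `Ω'_δ` coincide. Value-free, no conformal map. -/
def AnchorLocality : Prop :=
  ∀ (D D' : DobrushinDomain) (i : Fin 2) (ε : ℝ), D'.carrier ⊆ D.carrier → 0 < ε →
    D'.carrier ∩ ball (D.pt i) ε = D.carrier ∩ ball (D.pt i) ε →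
    ∀ c : ℝ, 0 < c → ∀ η : ℝ, 0 < η → ∃ r : ℝ, 0 < r ∧
      ∀ (x x' y : ℝ → Site 2),
        (∀ᶠ δ in 𝓝[>] (0 : ℝ), dist (meshPoint δ (x δ)) (D.pt i) < r) →
        (∀ᶠ δ in 𝓝[>] (0 : ℝ), dist (meshPoint δ (x' δ)) (D.pt i) < r) →
        (∀ᶠ δ in 𝓝[>] (0 : ℝ), c ≤ dist (meshPoint δ (y δ)) (D.pt i)) →
        (∀ᶠ δ in 𝓝[>] (0 : ℝ), (discreteDomainGraph D'.carrier δ).Reachable (x δ) (y δ) ∧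
          (discreteDomainGraph D'.carrier δ).Reachable (x' δ) (y δ)) →
        (∀ᶠ δ in 𝓝[>] (0 : ℝ), meshDomain D'.carrier δ ⊆ meshDomain D.carrier δ) →
        ∀ᶠ δ in 𝓝[>] (0 : ℝ),
          |T D'.carrier δ (x δ) (y δ) / T D'.carrier δ (x' δ) (y δ) /
              (T D.carrier δ (x δ) (y δ) / T D.carrier δ (x' δ) (y δ)) - 1| < η

/-- **Anchor transfer** (two ends, difference form; PROVED below from `AnchorLocality`): under the
crux's hypotheses, for every `η > 0` there is `r > 0` such that for bulk points `z, w ∈ D'` within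
`r` of `a = D.pt 0`, `b = D.pt 1`, the crux's nested ratio and the nested ratio of the bulk two-point
functions `⟨σ_{[z/δ]}σ_{[w/δ]}⟩^free` are eventually within `η`. -/
def AnchorTransfer : Prop :=
  ∀ (D D' : DobrushinDomain) (a b : ℝ → Site 2), SAW.IsEndpointApprox D a b →
    SAW.IsEndpointApprox D' a b → D'.carrier ⊆ D.carrier →
    (∃ ε : ℝ, 0 < ε ∧ D'.carrier ∩ ball (D.pt 0) ε = D.carrier ∩ ball (D.pt 0) ε ∧
      D'.carrier ∩ ball (D.pt 1) ε = D.carrier ∩ ball (D.pt 1) ε) →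
    ∀ η : ℝ, 0 < η → ∃ r : ℝ, 0 < r ∧ ∀ z w : ℂ, z ∈ D'.carrier → w ∈ D'.carrier →
      dist z (D.pt 0) < r → dist w (D.pt 1) < r →
      ∀ᶠ δ in 𝓝[>] (0 : ℝ),
        |T D'.carrier δ (a δ) (b δ) / T D.carrier δ (a δ) (b δ) -
          T D'.carrier δ (nearestSite δ z) (nearestSite δ w) /
            T D.carrier δ (nearestSite δ z) (nearestSite δ w)| < η

/-- **Bulk free two-point ratio** (CHI15 Thm 1.1, free boundary conditions, for the crux's
discretisation — graph `Ω_δ`, ALL its sites free —, in nested-ratio form): for fixed interior points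
`z ≠ w` of `D' ⊆ D`, `⟨σ_{[z/δ]}σ_{[w/δ]}⟩^free_{Ω'_δ} / ⟨σ_{[z/δ]}σ_{[w/δ]}⟩^free_{Ω_δ}` converges to
the ratio of CHI's explicit continuum free two-point functions (`twoPointFreeCHI`, eqs. (1.2)–(1.3))
of `D'` and `D`, written through the conformal charts `Φ ∘ φ⁻¹ : D' → ℍ` and `φ⁻¹ : D → ℍ` (any
conformal chart gives the same value; CHI's lattice normalisation `ϱ(δ)` cancels). -/
def BulkFreeRatio : Prop :=
  ∀ (D D' : DobrushinDomain), D'.carrier ⊆ D.carrier →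
    ∀ (φ : ConformalEquiv upperHalfPlaneSet D.carrier) (A : Set ℂ),
      A = closure (upperHalfPlaneSet \ {z | z ∈ upperHalfPlaneSet ∧ φ z ∈ D'.carrier}) →
    ∀ (Φ : ConformalEquiv (upperHalfPlaneSet \ A) upperHalfPlaneSet) (z w : ℂ),
      z ∈ D'.carrier → w ∈ D'.carrier → z ≠ w →
      Tendsto (fun δ => T D'.carrier δ (nearestSite δ z) (nearestSite δ w) /
          T D.carrier δ (nearestSite δ z) (nearestSite δ w)) (𝓝[>] 0)
        (𝓝 (twoPointFreeCHI (fun x => Φ (φ.symm x)) z w / twoPointFreeCHI (fun x => φ.symm x) z w))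

/-- **Boundary fusion** (continuum, explicit; the marked points of `D'` are those of `D` — idle for
the crux, Disproof §1, but they make `D'` a `MarkedDomain.IsHullSubdomain` of `D` verbatim, so that
`Negative.starHull_and_deriv_mem` gives `A ∈ 𝒬*`, `0 < d ≤ 1`): the ratio of CHI's free two-point
functions of `D' ⊆ D` tends to `d^{1/2} = Φ'_A(0)^{1/2}` as `(z, w) → (a, b)` inside `D'`. In the chart
`ζ = φ⁻¹ z → 0`, `ξ = φ⁻¹ w → ∞`: `u⁻¹ − u ∼ 2 Im ζ Im ξ / |ξ|²`, `Im Φζ / Im ζ → d`,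
`Im Φξ / Im ξ → 1`, `|Φ'(ζ)| → d`, `|Φ'(ξ)| → 1` (Schwarz reflection of `Φ_A` at `0` and `∞`), so the
ratio is `d^{1/2}·d^{-1/8}·d^{1/8} = d^{1/2}`; Carathéodory (Jordan `D`) sends `z → a`, `w → b` to
`ζ → 0`, `ξ → ∞`. -/
def BoundaryFusion : Prop :=
  ∀ (D D' : DobrushinDomain), D'.carrier ⊆ D.carrier → D'.pt 0 = D.pt 0 → D'.pt 1 = D.pt 1 →
    (∃ ε : ℝ, 0 < ε ∧ D'.carrier ∩ ball (D.pt 0) ε = D.carrier ∩ ball (D.pt 0) ε ∧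
      D'.carrier ∩ ball (D.pt 1) ε = D.carrier ∩ ball (D.pt 1) ε) →
    ∀ (φ : ConformalEquiv upperHalfPlaneSet D.carrier), D.IsChordalUniformizing φ →
    ∀ (A : Set ℂ), A = closure (upperHalfPlaneSet \ {z | z ∈ upperHalfPlaneSet ∧ φ z ∈ D'.carrier}) →
    ∀ (Φ : ConformalEquiv (upperHalfPlaneSet \ A) upperHalfPlaneSet) (d : ℝ),
      IsRestrictionMap A Φ → HasRestrictionDeriv A Φ d →
      Tendsto (fun p : ℂ × ℂ => twoPointFreeCHI (fun x => Φ (φ.symm x)) p.1 p.2 /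
          twoPointFreeCHI (fun x => φ.symm x) p.1 p.2)
        (𝓝[D'.carrier] (D.pt 0) ×ˢ 𝓝[D'.carrier] (D.pt 1)) (𝓝 (d ^ ((1 : ℝ) / 2)))

/-! ### The registered stubs (statements expanded over existing declarations; `T` is
`Summit.CriticalPhenomena.SAWScalingLimit.Theorems.IsingBoundaryRatio.Negative.T`, the landed normal form of the
crux's inline free two-point function — a worker's file needs the first two imports of this module (+ `PlanarIsingOnePointProofs`) and
`open Literature.Probability.LatticeModels Literature.Probability.RandomPlanarGeometry Filter Metric
Summit.CriticalPhenomena.SAWScalingLimit.Theorems.IsingBoundaryRatio.Negative` + `open scoped Topology`) -/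

/-! RESHAPED by the cycle-c1 line lead (2026-08-16): the rev-3 open stub `stub_anchorLocality`
(= `AnchorLocality`, one marked point at a time, ARBITRARY anchor and far families) is replaced by the
MINIMAL statement the composition consumes, `stub_anchorTransfer` (= `AnchorTransfer`: the two
endpoint families of the crux versus the rounded sites of two FIXED bulk points, difference form).
`AnchorLocality → AnchorTransfer` stays PROVED below (`anchorTransfer_of_anchorLocality`), so a proof of
the rev-3 stub still closes the line; and `anchorTransfer_of_normalForm` (PROVED below) shows the
converse `crux ⇒ AnchorTransfer` modulo the printed bulk limit X and the landed boundary fusion — the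
registered residual is crux-EQUIVALENT modulo print (no strictly smaller sufficient stub exists along
this line). -/

/-- STUB 1 (L, OPEN, HARDEST; = `AnchorTransfer`) — anchor transfer at the two free rough marked
prime ends: for the hull subdomain `D' ⊆ D` agreeing with `D` in `ε`-balls around `a = D.pt 0` and
`b = D.pt 1` and an endpoint approximation `(a_δ, b_δ)` of `D'` (hence of `D`), for every `η > 0`
there is `r > 0` such that for all bulk points `z, w ∈ D'` with `|z - a| < r`, `|w - b| < r`,
eventually along `δ → 0⁺`
`|⟨σ_{a_δ}σ_{b_δ}⟩_{Ω'_δ}/⟨σ_{a_δ}σ_{b_δ}⟩_{Ω_δ} - ⟨σ_{[z/δ]}σ_{[w/δ]}⟩_{Ω'_δ}/⟨σ_{[z/δ]}σ_{[w/δ]}⟩_{Ω_δ}| < η`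
(`T` = the landed normal form of the crux's free critical two-point function; `[z/δ] = nearestSite δ z`).
Unprinted (triage r1 common doubt; HK13 Thm 29 prints the one-rough-point ratio principle only with
the second point on a straight boundary part, CS12 Thm 1.2 needs a straight segment at the target,
CHI21 admits boundary spins only on regular parts of free arcs): the rough local factors at `a` and
`b` must cancel between `D` and `D'`. FK reading (Edwards–Sokal, landed `stub_T_eq_fkConn`):
arm-origin forgetting for critical FK-Ising connection probabilities at a free Jordan prime end. -/
theorem stub_anchorTransfer :
    ∀ (D D' : DobrushinDomain) (a b : ℝ → Site 2), SAW.IsEndpointApprox D a b →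
      SAW.IsEndpointApprox D' a b → D'.carrier ⊆ D.carrier →
      (∃ ε : ℝ, 0 < ε ∧ D'.carrier ∩ Metric.ball (D.pt 0) ε = D.carrier ∩ Metric.ball (D.pt 0) ε ∧
        D'.carrier ∩ Metric.ball (D.pt 1) ε = D.carrier ∩ Metric.ball (D.pt 1) ε) →
      ∀ η : ℝ, 0 < η → ∃ r : ℝ, 0 < r ∧ ∀ z w : ℂ, z ∈ D'.carrier → w ∈ D'.carrier →
        dist z (D.pt 0) < r → dist w (D.pt 1) < r →
        ∀ᶠ δ in 𝓝[>] (0 : ℝ),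
          |T D'.carrier δ (a δ) (b δ) / T D.carrier δ (a δ) (b δ) -
            T D'.carrier δ (nearestSite δ z) (nearestSite δ w) /
              T D.carrier δ (nearestSite δ z) (nearestSite δ w)| < η := by
  sorry

/-! STUB 2 (L, PRINTED THEOREM; = `BulkFreeRatio`) — CHI15 (arXiv:1202.2838) Thm 1.1, free boundary
conditions, for the crux's discretisation of the Jordan domains `D'` and `D` (graph `Ω_δ`, all sites free
— one boundary layer more than the tree's `meshIsingFreeCorr`, volume `meshInteriorFinset`), divided:
`ϱ(δ)` cancels and the explicit limit `twoPointFreeCHI ψ z w` is positive for `z ≠ w` (`u < 1`). Tree: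
`tendsto_twoPoint_free_rho_of_ratios` / `chi_twoPoint_rho_of_ratios` give CHI Thm 1.1 (free) for the
tree's convention modulo CHI Prop 2.20 / Thm 1.7 (hypotheses `hR`, `hB`, unproved). -/

/-- STUB 2' (NAMED FACT X — debt queue, NOT a worker task): CHI15 Thm 1.1 with free boundary
conditions, `ϱ`-normalised, for the canonical discretisation of a Jordan domain — the Literature fact
`Literature.Probability.LatticeModels.chi_twoPoint_free_jordan` (landed p88667, file
`Literature/Probability/LatticeModels/PlanarIsingFreeTwoPointJordan.lean`, unproved: its proof is the
discrete-holomorphic spinor analysis of CHI15 §§2–3). The line is CLOSED MODULO this fact and STUB 1. -/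
theorem stub_chiTwoPointFreeJordan : Literature.Probability.LatticeModels.chi_twoPoint_free_jordan := by
  sorry

/-- STUB 2 (= `BulkFreeRatio`; PROVED from STUB 2' by the landed reduction
`Theorems.IsingBoundaryRatio.bulkFreeRatio_of_chi`, p91239). -/
theorem stub_bulkFreeRatio :
    ∀ (D D' : DobrushinDomain), D'.carrier ⊆ D.carrier →
      ∀ (φ : ConformalEquiv UpperHalfPlane.upperHalfPlaneSet D.carrier) (A : Set ℂ),
        A = closure (UpperHalfPlane.upperHalfPlaneSet \
          {z | z ∈ UpperHalfPlane.upperHalfPlaneSet ∧ φ z ∈ D'.carrier}) →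
      ∀ (Φ : ConformalEquiv (UpperHalfPlane.upperHalfPlaneSet \ A) UpperHalfPlane.upperHalfPlaneSet)
        (z w : ℂ), z ∈ D'.carrier → w ∈ D'.carrier → z ≠ w →
        Tendsto (fun δ => T D'.carrier δ (nearestSite δ z) (nearestSite δ w) /
            T D.carrier δ (nearestSite δ z) (nearestSite δ w)) (𝓝[>] 0)
          (𝓝 (twoPointFreeCHI (fun x => Φ (φ.symm x)) z w /
            twoPointFreeCHI (fun x => φ.symm x) z w)) :=
  Summit.CriticalPhenomena.SAWScalingLimit.Theorems.IsingBoundaryRatio.bulkFreeRatio_of_chi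
    stub_chiTwoPointFreeJordan

/-! ### Reshaped by the line lead (2026-08-16, cycle 1): `BoundaryFusion` is split into two
restriction-map lemmas (behaviour of `Φ_A` at `0` and at `∞`) and the fusion algebra proper.
The composition is unchanged: `boundaryFusion_holds` below is now PROVED from the three new stubs. -/

/-- **Restriction map at `0`** (Schwarz reflection of `Φ_A` at `0`, [LSW] proof of Lemma 3.5):
for a `*`-hull `A`, a restriction map `Φ` of `A` with `Φ'_A(0) = d`, as `ζ → 0` inside `ℍ ∖ A`:
`Im Φ(ζ) / Im ζ → d` (every manner of approach: the reflection `F` of `Φ` is holomorphic near `0`,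
real on the real axis, `F'(0) = d`, and `Im F(ζ) = Im ζ · Re F'(Re ζ + it*)` by the mean value
theorem on the vertical segment) and `Φ'(ζ) → d` (continuity of `F'`). Tree:
`IsRestrictionMap.exists_reflection` (RestrictionMapReflection.lean). -/
def RestrictionMapAtZero : Prop :=
  ∀ (A : Set ℂ) (Φ : ConformalEquiv (upperHalfPlaneSet \ A) upperHalfPlaneSet) (d : ℝ),
    IsStarHull A → IsRestrictionMap A Φ → HasRestrictionDeriv A Φ d →
    Tendsto (fun ζ : ℂ => (Φ ζ).im / ζ.im) (𝓝[upperHalfPlaneSet \ A] 0) (𝓝 d) ∧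
    Tendsto (fun ζ : ℂ => deriv (fun x => Φ x) ζ) (𝓝[upperHalfPlaneSet \ A] 0) (𝓝 (d : ℂ))

/-- **Restriction map at `∞`** (hydrodynamic expansion `Φ_A(ξ) = ξ + a₀ + O(1/ξ)` with real
coefficients): for a `*`-hull `A` and a restriction map `Φ` of `A`, as `ξ → ∞` inside `ℍ ∖ A`:
`Im Φ(ξ) / Im ξ → 1` and `Φ'(ξ) → 1`. Intended proof: INVERSION — `Ψ(w) = −d / Φ(−1/w)` is a
restriction map of the `*`-hull `A' = {−1/z | z ∈ A}` with `Ψ'_{A'}(0) = d`, and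
`Im Φ(z)/Im z = d · (Im Ψ w / Im w) · (‖w‖²/‖Ψ w‖²)`, `Φ'(z) = d Ψ'(w) w² / Ψ(w)²` (`w = −1/z`), so
the statement at `∞` is the statement at `0` (`RestrictionMapAtZero`) for `(A', Ψ, d)`. -/
def RestrictionMapAtInfty : Prop :=
  ∀ (A : Set ℂ) (Φ : ConformalEquiv (upperHalfPlaneSet \ A) upperHalfPlaneSet),
    IsStarHull A → IsRestrictionMap A Φ →
    Tendsto (fun ξ : ℂ => (Φ ξ).im / ξ.im) (cocompact ℂ ⊓ 𝓟 (upperHalfPlaneSet \ A)) (𝓝 1) ∧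
    Tendsto (fun ξ : ℂ => deriv (fun x => Φ x) ξ) (cocompact ℂ ⊓ 𝓟 (upperHalfPlaneSet \ A)) (𝓝 1)

/-- STUB 3a (S–M, complex analysis near `0`; = `RestrictionMapAtZero`). -/
theorem stub_restrictionMapAtZero :
    ∀ (A : Set ℂ) (Φ : ConformalEquiv (UpperHalfPlane.upperHalfPlaneSet \ A) UpperHalfPlane.upperHalfPlaneSet)
      (d : ℝ), IsStarHull A → IsRestrictionMap A Φ → HasRestrictionDeriv A Φ d →
      Tendsto (fun ζ : ℂ => (Φ ζ).im / ζ.im) (𝓝[UpperHalfPlane.upperHalfPlaneSet \ A] 0) (𝓝 d) ∧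
      Tendsto (fun ζ : ℂ => deriv (fun x => Φ x) ζ) (𝓝[UpperHalfPlane.upperHalfPlaneSet \ A] 0)
        (𝓝 (d : ℂ)) :=
  Summit.CriticalPhenomena.SAWScalingLimit.Theorems.IsingBoundaryRatio.stub_restrictionMapAtZero

/-- STUB 3b (M, inversion `w = −1/z`; = `RestrictionMapAtZero → RestrictionMapAtInfty`). -/
theorem stub_restrictionMapAtInfty :
    (∀ (A : Set ℂ) (Φ : ConformalEquiv (UpperHalfPlane.upperHalfPlaneSet \ A) UpperHalfPlane.upperHalfPlaneSet)
      (d : ℝ), IsStarHull A → IsRestrictionMap A Φ → HasRestrictionDeriv A Φ d →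
      Tendsto (fun ζ : ℂ => (Φ ζ).im / ζ.im) (𝓝[UpperHalfPlane.upperHalfPlaneSet \ A] 0) (𝓝 d) ∧
      Tendsto (fun ζ : ℂ => deriv (fun x => Φ x) ζ) (𝓝[UpperHalfPlane.upperHalfPlaneSet \ A] 0)
        (𝓝 (d : ℂ))) →
    ∀ (A : Set ℂ) (Φ : ConformalEquiv (UpperHalfPlane.upperHalfPlaneSet \ A) UpperHalfPlane.upperHalfPlaneSet),
      IsStarHull A → IsRestrictionMap A Φ →
      Tendsto (fun ξ : ℂ => (Φ ξ).im / ξ.im)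
        (cocompact ℂ ⊓ 𝓟 (UpperHalfPlane.upperHalfPlaneSet \ A)) (𝓝 1) ∧
      Tendsto (fun ξ : ℂ => deriv (fun x => Φ x) ξ)
        (cocompact ℂ ⊓ 𝓟 (UpperHalfPlane.upperHalfPlaneSet \ A)) (𝓝 1) :=
  Summit.CriticalPhenomena.SAWScalingLimit.Theorems.IsingBoundaryRatio.stub_restrictionMapAtInfty

/-- STUB 3c (M, explicit algebra + Carathéodory; = `RestrictionMapAtZero → RestrictionMapAtInfty →
BoundaryFusion`) — the ratio of CHI's explicit free two-point functions of `D' ⊆ D` fuses to `d^{1/2}`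
at the two common marked points: in the chart `ζ = φ⁻¹ z → 0` (`IsChordalUniformizing.tendsto_symm_nhds_zero`),
`ξ = φ⁻¹ w → ∞` (`IsChordalUniformizing.tendsto_symm_cocompact`), with `u⁻¹ − u =
4 Im ζ Im ξ / ((‖ξ−ζ̄‖ + ‖ξ−ζ‖) √(‖ξ−ζ‖‖ξ−ζ̄‖))` (`norm_sub_conj_sq`), the ratio equals
`√[(Im Φζ/Im ζ)(Im Φξ/Im ξ)(N/N')] · (Im ζ/Im Φζ)^{1/8} (Im ξ/Im Φξ)^{1/8} ‖Φ'ζ‖^{1/8} ‖Φ'ξ‖^{1/8}`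
(chain rule `(Φ ∘ φ⁻¹)' = Φ'(φ⁻¹ ·) · (φ⁻¹)'`, `(φ⁻¹)' ≠ 0`), which tends to
`d^{1/2} · d^{−1/8} · d^{1/8} = d^{1/2}` by the two restriction-map stubs (`0 < d`,
`Negative.starHull_and_deriv_mem`; `φ⁻¹(D') ⊆ ℍ ∖ A`). -/
theorem stub_boundaryFusionCore :
    (∀ (A : Set ℂ) (Φ : ConformalEquiv (UpperHalfPlane.upperHalfPlaneSet \ A) UpperHalfPlane.upperHalfPlaneSet)
      (d : ℝ), IsStarHull A → IsRestrictionMap A Φ → HasRestrictionDeriv A Φ d →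
      Tendsto (fun ζ : ℂ => (Φ ζ).im / ζ.im) (𝓝[UpperHalfPlane.upperHalfPlaneSet \ A] 0) (𝓝 d) ∧
      Tendsto (fun ζ : ℂ => deriv (fun x => Φ x) ζ) (𝓝[UpperHalfPlane.upperHalfPlaneSet \ A] 0)
        (𝓝 (d : ℂ))) →
    (∀ (A : Set ℂ) (Φ : ConformalEquiv (UpperHalfPlane.upperHalfPlaneSet \ A) UpperHalfPlane.upperHalfPlaneSet),
      IsStarHull A → IsRestrictionMap A Φ →
      Tendsto (fun ξ : ℂ => (Φ ξ).im / ξ.im)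
        (cocompact ℂ ⊓ 𝓟 (UpperHalfPlane.upperHalfPlaneSet \ A)) (𝓝 1) ∧
      Tendsto (fun ξ : ℂ => deriv (fun x => Φ x) ξ)
        (cocompact ℂ ⊓ 𝓟 (UpperHalfPlane.upperHalfPlaneSet \ A)) (𝓝 1)) →
    ∀ (D D' : DobrushinDomain), D'.carrier ⊆ D.carrier → D'.pt 0 = D.pt 0 → D'.pt 1 = D.pt 1 →
      (∃ ε : ℝ, 0 < ε ∧ D'.carrier ∩ Metric.ball (D.pt 0) ε = D.carrier ∩ Metric.ball (D.pt 0) ε ∧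
        D'.carrier ∩ Metric.ball (D.pt 1) ε = D.carrier ∩ Metric.ball (D.pt 1) ε) →
      ∀ (φ : ConformalEquiv UpperHalfPlane.upperHalfPlaneSet D.carrier), D.IsChordalUniformizing φ →
      ∀ (A : Set ℂ), A = closure (UpperHalfPlane.upperHalfPlaneSet \
          {z | z ∈ UpperHalfPlane.upperHalfPlaneSet ∧ φ z ∈ D'.carrier}) →
      ∀ (Φ : ConformalEquiv (UpperHalfPlane.upperHalfPlaneSet \ A) UpperHalfPlane.upperHalfPlaneSet)
        (d : ℝ), IsRestrictionMap A Φ → HasRestrictionDeriv A Φ d →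
        Tendsto (fun p : ℂ × ℂ => twoPointFreeCHI (fun x => Φ (φ.symm x)) p.1 p.2 /
            twoPointFreeCHI (fun x => φ.symm x) p.1 p.2)
          (𝓝[D'.carrier] (D.pt 0) ×ˢ 𝓝[D'.carrier] (D.pt 1)) (𝓝 (d ^ ((1 : ℝ) / 2))) :=
  Summit.CriticalPhenomena.SAWScalingLimit.Theorems.IsingBoundaryRatio.stub_boundaryFusionCore

/-- `BoundaryFusion` from the three reshaped stubs (PROVED: modus ponens). -/
theorem stub_boundaryFusion : BoundaryFusion :=
  stub_boundaryFusionCore stub_restrictionMapAtZero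
    (stub_restrictionMapAtInfty stub_restrictionMapAtZero)

/-! ### Consistency: each named statement IS its registered stub (definitionally) -/

theorem anchorTransfer_holds : AnchorTransfer := stub_anchorTransfer
theorem bulkFreeRatio_holds : BulkFreeRatio := stub_bulkFreeRatio
theorem boundaryFusion_holds : BoundaryFusion := stub_boundaryFusion
theorem restrictionMapAtZero_holds : RestrictionMapAtZero := stub_restrictionMapAtZero
theorem restrictionMapAtInfty_holds : RestrictionMapAtInfty :=
  stub_restrictionMapAtInfty stub_restrictionMapAtZero

/-! ### Lattice and algebra helpers (proved) -/

/-- `⟨σ_xσ_y⟩ = ⟨σ_yσ_x⟩` for the crux's two-point function. -/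
theorem T_comm (Ω : Set ℂ) (δ : ℝ) (x y : Site 2) : T Ω δ x y = T Ω δ y x := by
  unfold T isingTwoPoint spinPair
  congr 1
  funext σ
  ring

/-- Pure real-arithmetic core of the two-end transfer: two double ratios within `η₁ ≤ 1` of `1`
and the GKS bound `W' ≤ W` give `|A'/A − W'/W| < 3η₁ ≤ η`. -/
theorem transfer_algebra {A' A Z' Z W' W η₁ η : ℝ} (hA : 0 < A) (hZ' : 0 < Z') (hZ : 0 < Z)
    (hW' : 0 < W') (hW : 0 < W) (hWW : W' ≤ W) (hη₁ : η₁ ≤ 1) (hη : 3 * η₁ ≤ η)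
    (h₁ : |A' / Z' / (A / Z) - 1| < η₁) (h₂ : |Z' / W' / (Z / W) - 1| < η₁) :
    |A' / A - W' / W| < η := by
  have hA0 : A ≠ 0 := hA.ne'
  have hZ'0 : Z' ≠ 0 := hZ'.ne'
  have hZ0 : Z ≠ 0 := hZ.ne'
  have hW'0 : W' ≠ 0 := hW'.ne'
  have hW0 : W ≠ 0 := hW.ne'
  set X := A' / Z' / (A / Z) with hX
  set Y := Z' / W' / (Z / W) with hY
  have key : A' / A = X * Y * (W' / W) := by
    simp only [hX, hY]
    field_simp
  have hB0 : 0 < W' / W := div_pos hW' hW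
  have hB1 : W' / W ≤ 1 := (div_le_one hW).2 hWW
  have hYb : |Y| ≤ 1 + η₁ := by
    calc |Y| = |(Y - 1) + 1| := by rw [sub_add_cancel]
      _ ≤ |Y - 1| + |(1 : ℝ)| := abs_add_le _ _
      _ ≤ 1 + η₁ := by rw [abs_one]; linarith [h₂.le]
  have hXY : |X * Y - 1| < 3 * η₁ := by
    have e : X * Y - 1 = (X - 1) * Y + (Y - 1) := by ring
    rw [e]
    have h3 : |(X - 1) * Y| ≤ |X - 1| * (1 + η₁) := by
      rw [abs_mul]
      exact mul_le_mul_of_nonneg_left hYb (abs_nonneg _)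
    have h4 : |X - 1| * (1 + η₁) < η₁ * (1 + η₁) :=
      mul_lt_mul_of_pos_right h₁ (by linarith [abs_nonneg (X - 1)])
    have h5 : η₁ * (1 + η₁) ≤ 2 * η₁ := by nlinarith [abs_nonneg (X - 1)]
    calc |(X - 1) * Y + (Y - 1)| ≤ |(X - 1) * Y| + |Y - 1| := abs_add_le _ _
      _ < 3 * η₁ := by linarith
  calc |A' / A - W' / W| = |W' / W| * |X * Y - 1| := by
        rw [key, ← abs_mul]
        congr 1
        ring
    _ ≤ 1 * |X * Y - 1| := by
        gcongr
        rw [abs_of_pos hB0]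
        exact hB1
    _ < η := by linarith

/-- Interior points `z, w` of the subdomain: their nearest sites are eventually joined in `Ω'_δ`
to the endpoint approximation and to each other (largest mesh component of a Jordan domain,
`JordanDomain.eventually_forall_mem_meshDomain'`). -/
theorem eventually_bulk_reachable {D' : DobrushinDomain} {a b : ℝ → Site 2}
    (hD' : SAW.IsEndpointApprox D' a b) {z w : ℂ} (hz : z ∈ D'.carrier) (hw : w ∈ D'.carrier) :
    ∀ᶠ δ in 𝓝[>] (0 : ℝ),
      (discreteDomainGraph D'.carrier δ).Reachable (nearestSite δ z) (b δ) ∧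
      (discreteDomainGraph D'.carrier δ).Reachable (nearestSite δ z) (nearestSite δ w) := by
  obtain ⟨ρz, hρz, hballz⟩ := Metric.isOpen_iff.1 D'.isOpen z hz
  obtain ⟨ρw, hρw, hballw⟩ := Metric.isOpen_iff.1 D'.isOpen w hw
  have hK : IsCompact (closedBall z (ρz / 2) ∪ closedBall w (ρw / 2)) :=
    (isCompact_closedBall _ _).union (isCompact_closedBall _ _)
  have hKD' : closedBall z (ρz / 2) ∪ closedBall w (ρw / 2) ⊆ D'.carrier :=
    union_subset ((closedBall_subset_ball (by linarith)).trans hballz)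
      ((closedBall_subset_ball (by linarith)).trans hballw)
  filter_upwards [hD'.reachable, eventually_ne hD',
    D'.toJordanDomain.eventually_forall_mem_meshDomain' hK hKD',
    Ioo_mem_nhdsGT (lt_min (half_pos hρz) (half_pos hρw))] with δ hr hne hJ hδ
  have hzK : meshPoint δ (nearestSite δ z) ∈ closedBall z (ρz / 2) ∪ closedBall w (ρw / 2) :=
    Or.inl (mem_closedBall.2 ((dist_meshPoint_nearestSite_le hδ.1 z).trans
      (hδ.2.le.trans (min_le_left _ _))))
  have hwK : meshPoint δ (nearestSite δ w) ∈ closedBall z (ρz / 2) ∪ closedBall w (ρw / 2) :=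
    Or.inr (mem_closedBall.2 ((dist_meshPoint_nearestSite_le hδ.1 w).trans
      (hδ.2.le.trans (min_le_right _ _))))
  have hzD : nearestSite δ z ∈ meshDomain D'.carrier δ := hJ.1 _ hzK
  have hwD : nearestSite δ w ∈ meshDomain D'.carrier δ := hJ.1 _ hwK
  have hbD : b δ ∈ meshDomain D'.carrier δ := mem_meshDomain_of_reachable_ne hr.symm (Ne.symm hne)
  have key : ∀ u v : Site 2, u ∈ meshDomain D'.carrier δ → v ∈ meshDomain D'.carrier δ →
      (discreteDomainGraph D'.carrier δ).Reachable u v := by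
    intro u v hu hv
    obtain ⟨hu', hv', hreach⟩ := hJ.2 u hu v hv
    obtain ⟨p⟩ := hreach
    exact reachable_discreteDomainGraph_of_walk p hu
  exact ⟨key _ _ hzD hbD, key _ _ hzD hwD⟩

/-! ### The two-end transfer from anchor locality (PROVED) -/

/-- `AnchorLocality → AnchorTransfer`: apply anchor locality at `a` (anchors `a_δ`, `[z/δ]`; far
spin `b_δ`) and at `b` (anchors `b_δ`, `[w/δ]`; far spin `[z/δ]`), multiply the two double ratios
(symmetry `⟨σ_xσ_y⟩ = ⟨σ_yσ_x⟩`), and pass to the difference form with the GKS bound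
`⟨σ_{[z]}σ_{[w]}⟩_{Ω'} ≤ ⟨σ_{[z]}σ_{[w]}⟩_{Ω}` (`T_mono`) and strict positivity (`T_pos_of_reachable`). -/
theorem anchorTransfer_of_anchorLocality (hL : AnchorLocality) : AnchorTransfer := by
  intro D D' a b hD hD' hsub hε η hη
  obtain ⟨ε, hε0, hb0, hb1⟩ := hε
  have hab : D.pt 0 ≠ D.pt 1 := fun h => absurd (D.pt_injective h) (by decide)
  set L := dist (D.pt 0) (D.pt 1) with hLdef
  have hL0 : 0 < L := dist_pos.2 hab
  set η₁ : ℝ := min 1 (η / 3) with hη₁def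
  have hη₁0 : 0 < η₁ := lt_min one_pos (by positivity)
  have hη₁1 : η₁ ≤ 1 := min_le_left _ _
  have hη₁3 : 3 * η₁ ≤ η := by
    have := min_le_right 1 (η / 3)
    linarith
  obtain ⟨r₁, hr₁, H₁⟩ := hL D D' 0 ε hsub hε0 hb0 (L / 2) (half_pos hL0) η₁ hη₁0
  obtain ⟨r₂, hr₂, H₂⟩ := hL D D' 1 ε hsub hε0 hb1 (L / 2) (half_pos hL0) η₁ hη₁0
  refine ⟨min (min r₁ r₂) (L / 4), lt_min (lt_min hr₁ hr₂) (by positivity), ?_⟩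
  intro z w hz hw hzr hwr
  have hzr₁ : dist z (D.pt 0) < r₁ := lt_of_lt_of_le hzr ((min_le_left _ _).trans (min_le_left _ _))
  have hwr₂ : dist w (D.pt 1) < r₂ := lt_of_lt_of_le hwr ((min_le_left _ _).trans (min_le_right _ _))
  have hzL : dist z (D.pt 0) < L / 4 := lt_of_lt_of_le hzr (min_le_right _ _)
  -- eventual facts along `δ → 0⁺`
  have hnest := eventually_meshDomain_subset hD hD' hsub
  have hbulk := eventually_bulk_reachable hD' hz hw
  have ex_a : ∀ᶠ δ in 𝓝[>] (0 : ℝ), dist (meshPoint δ (a δ)) (D.pt 0) < r₁ :=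
    (Metric.tendsto_nhds.1 hD.tendsto_fst) r₁ hr₁
  have ex_z : ∀ᶠ δ in 𝓝[>] (0 : ℝ), dist (meshPoint δ (nearestSite δ z)) (D.pt 0) < r₁ := by
    filter_upwards [Ioo_mem_nhdsGT (sub_pos.2 hzr₁)] with δ hδ
    calc dist (meshPoint δ (nearestSite δ z)) (D.pt 0)
        ≤ dist (meshPoint δ (nearestSite δ z)) z + dist z (D.pt 0) := dist_triangle _ _ _
      _ ≤ δ + dist z (D.pt 0) := by
          gcongr
          exact dist_meshPoint_nearestSite_le hδ.1 z
      _ < r₁ := by linarith [hδ.2]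
  have ex_b : ∀ᶠ δ in 𝓝[>] (0 : ℝ), dist (meshPoint δ (b δ)) (D.pt 1) < r₂ :=
    (Metric.tendsto_nhds.1 hD.tendsto_snd) r₂ hr₂
  have ex_w : ∀ᶠ δ in 𝓝[>] (0 : ℝ), dist (meshPoint δ (nearestSite δ w)) (D.pt 1) < r₂ := by
    filter_upwards [Ioo_mem_nhdsGT (sub_pos.2 hwr₂)] with δ hδ
    calc dist (meshPoint δ (nearestSite δ w)) (D.pt 1)
        ≤ dist (meshPoint δ (nearestSite δ w)) w + dist w (D.pt 1) := dist_triangle _ _ _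
      _ ≤ δ + dist w (D.pt 1) := by
          gcongr
          exact dist_meshPoint_nearestSite_le hδ.1 w
      _ < r₂ := by linarith [hδ.2]
  have far_b : ∀ᶠ δ in 𝓝[>] (0 : ℝ), L / 2 ≤ dist (meshPoint δ (b δ)) (D.pt 0) := by
    filter_upwards [(Metric.tendsto_nhds.1 hD.tendsto_snd) (L / 2) (half_pos hL0)] with δ hδ
    have h3 := dist_triangle (D.pt 0) (meshPoint δ (b δ)) (D.pt 1)
    rw [dist_comm (D.pt 0) (meshPoint δ (b δ))] at h3
    linarith
  have far_z : ∀ᶠ δ in 𝓝[>] (0 : ℝ), L / 2 ≤ dist (meshPoint δ (nearestSite δ z)) (D.pt 1) := by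
    filter_upwards [Ioo_mem_nhdsGT (show (0 : ℝ) < L / 4 by positivity)] with δ hδ
    have h1 : dist (meshPoint δ (nearestSite δ z)) z ≤ δ := dist_meshPoint_nearestSite_le hδ.1 z
    have h2 := dist_triangle (D.pt 0) z (D.pt 1)
    have h3 := dist_triangle z (meshPoint δ (nearestSite δ z)) (D.pt 1)
    rw [dist_comm z (meshPoint δ (nearestSite δ z))] at h3
    rw [dist_comm (D.pt 0) z] at h2
    linarith [hδ.2]
  have reach₁ : ∀ᶠ δ in 𝓝[>] (0 : ℝ), (discreteDomainGraph D'.carrier δ).Reachable (a δ) (b δ) ∧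
      (discreteDomainGraph D'.carrier δ).Reachable (nearestSite δ z) (b δ) := by
    filter_upwards [hD'.reachable, hbulk] with δ h1 h2
    exact ⟨h1, h2.1⟩
  have reach₂ : ∀ᶠ δ in 𝓝[>] (0 : ℝ),
      (discreteDomainGraph D'.carrier δ).Reachable (b δ) (nearestSite δ z) ∧
      (discreteDomainGraph D'.carrier δ).Reachable (nearestSite δ w) (nearestSite δ z) := by
    filter_upwards [hbulk] with δ h2
    exact ⟨h2.1.symm, h2.2.symm⟩
  have E₁ := H₁ a (fun δ => nearestSite δ z) b ex_a ex_z far_b reach₁ hnest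
  have E₂ := H₂ b (fun δ => nearestSite δ w) (fun δ => nearestSite δ z) ex_b ex_w far_z reach₂ hnest
  filter_upwards [E₁, E₂, hbulk, hD'.reachable, hnest, self_mem_nhdsWithin] with δ h₁ h₂ hbk hr' hΛ hδ
  have hδ0 : (0 : ℝ) < δ := hδ
  have hbdd' : Bornology.IsBounded D'.carrier := D.isBounded.subset hsub
  have hmono : discreteDomainGraph D'.carrier δ ≤ discreteDomainGraph D.carrier δ :=
    discreteDomainGraph_mono hsub hΛ
  have h₁' : |T D'.carrier δ (a δ) (b δ) / T D'.carrier δ (nearestSite δ z) (b δ) /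
      (T D.carrier δ (a δ) (b δ) / T D.carrier δ (nearestSite δ z) (b δ)) - 1| < η₁ := h₁
  have h₂' : |T D'.carrier δ (b δ) (nearestSite δ z) / T D'.carrier δ (nearestSite δ w) (nearestSite δ z) /
      (T D.carrier δ (b δ) (nearestSite δ z) / T D.carrier δ (nearestSite δ w) (nearestSite δ z)) - 1| < η₁ := h₂
  rw [T_comm D'.carrier δ (b δ), T_comm D.carrier δ (b δ), T_comm D'.carrier δ (nearestSite δ w),
    T_comm D.carrier δ (nearestSite δ w)] at h₂'
  -- positivity (GKS I via the high-temperature expansion) and the GKS-II sandwich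
  have pab : 0 < T D.carrier δ (a δ) (b δ) := T_pos_of_reachable D.isBounded hδ0 (hr'.mono hmono)
  have pzb' : 0 < T D'.carrier δ (nearestSite δ z) (b δ) := T_pos_of_reachable hbdd' hδ0 hbk.1
  have pzb : 0 < T D.carrier δ (nearestSite δ z) (b δ) :=
    T_pos_of_reachable D.isBounded hδ0 (hbk.1.mono hmono)
  have pzw' : 0 < T D'.carrier δ (nearestSite δ z) (nearestSite δ w) := T_pos_of_reachable hbdd' hδ0 hbk.2
  have pzw : 0 < T D.carrier δ (nearestSite δ z) (nearestSite δ w) :=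
    T_pos_of_reachable D.isBounded hδ0 (hbk.2.mono hmono)
  have hWW : T D'.carrier δ (nearestSite δ z) (nearestSite δ w) ≤
      T D.carrier δ (nearestSite δ z) (nearestSite δ w) := by
    by_cases hzw : nearestSite δ z = nearestSite δ w
    · rw [hzw, T_self, T_self]
    · obtain ⟨hx, hy⟩ := mem_meshDomainFinset_of_reachable_ne hbdd' hδ0 hbk.2 hzw
      exact T_mono D.isBounded hδ0 hsub hΛ hx hy
  exact transfer_algebra pab pzb' pzb pzw' pzw hWW hη₁1 hη₁3 h₁' h₂'

/-! ### The `3η` assembly (PROVED) -/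

/-- **Transfer**: anchor transfer + bulk free ratio + boundary fusion ⇒ the crux, by a `3η`
argument: given `e`, take `r` from `AnchorTransfer` and bulk points `(z, w)` — which exist because
the product filter `𝓝[D'] a ×ˢ 𝓝[D'] b` is non-trivial (`a, b ∈ ∂D' ⊆ closure D'`) — with
`z, w ∈ D'`, `r`-close to `a, b`, `z ≠ w`, and the continuum ratio within `e/3` of `d^{1/2}`
(`BoundaryFusion`); then `BulkFreeRatio` at `(z, w)` pins the lattice bulk ratio. -/
theorem normalForm_of_transfer (hK1 : AnchorTransfer) (hK2 : BulkFreeRatio)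
    (hK3 : BoundaryFusion) : NormalForm := by
  intro D D' a b hD hD' hsub h0 h1 hε φ hφ A hA Φ d hΦ hd
  rw [Metric.tendsto_nhds]
  intro e he
  have he3 : 0 < e / 3 := by positivity
  obtain ⟨r, hr, H1⟩ := hK1 D D' a b hD hD' hsub hε (e / 3) he3
  have H3 := hK3 D D' hsub h0 h1 hε φ hφ A hA Φ d hΦ hd
  have hab : D.pt 0 ≠ D.pt 1 := fun h => absurd (D.pt_injective h) (by decide)
  set L := dist (D.pt 0) (D.pt 1) with hLdef
  have hL0 : 0 < L := dist_pos.2 hab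
  have hcl0 : D.pt 0 ∈ closure D'.carrier := h0 ▸ frontier_subset_closure (D'.pt_mem_frontier 0)
  have hcl1 : D.pt 1 ∈ closure D'.carrier := h1 ▸ frontier_subset_closure (D'.pt_mem_frontier 1)
  haveI i0 : (𝓝[D'.carrier] (D.pt 0)).NeBot := mem_closure_iff_nhdsWithin_neBot.1 hcl0
  haveI i1 : (𝓝[D'.carrier] (D.pt 1)).NeBot := mem_closure_iff_nhdsWithin_neBot.1 hcl1
  haveI : (𝓝[D'.carrier] (D.pt 0) ×ˢ 𝓝[D'.carrier] (D.pt 1)).NeBot := prod_neBot.2 ⟨i0, i1⟩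
  have hρ0 : 0 < min r (L / 2) := lt_min hr (half_pos hL0)
  have ev1 : ∀ᶠ p : ℂ × ℂ in 𝓝[D'.carrier] (D.pt 0) ×ˢ 𝓝[D'.carrier] (D.pt 1),
      p.1 ∈ D'.carrier ∩ ball (D.pt 0) (min r (L / 2)) :=
    tendsto_fst.eventually (inter_mem self_mem_nhdsWithin
      (mem_nhdsWithin_of_mem_nhds (ball_mem_nhds _ hρ0)))
  have ev2 : ∀ᶠ p : ℂ × ℂ in 𝓝[D'.carrier] (D.pt 0) ×ˢ 𝓝[D'.carrier] (D.pt 1),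
      p.2 ∈ D'.carrier ∩ ball (D.pt 1) (min r (L / 2)) :=
    tendsto_snd.eventually (inter_mem self_mem_nhdsWithin
      (mem_nhdsWithin_of_mem_nhds (ball_mem_nhds _ hρ0)))
  have ev3 := Metric.tendsto_nhds.1 H3 _ he3
  obtain ⟨p, ⟨hz, hzρ⟩, ⟨hw, hwρ⟩, h3⟩ := (ev1.and (ev2.and ev3)).exists
  rw [mem_ball] at hzρ hwρ
  have hzr : dist p.1 (D.pt 0) < r := lt_of_lt_of_le hzρ (min_le_left _ _)
  have hwr : dist p.2 (D.pt 1) < r := lt_of_lt_of_le hwρ (min_le_left _ _)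
  have hne : p.1 ≠ p.2 := by
    intro hzw
    have h1' : dist p.1 (D.pt 0) < L / 2 := lt_of_lt_of_le hzρ (min_le_right _ _)
    have h2' : dist p.2 (D.pt 1) < L / 2 := lt_of_lt_of_le hwρ (min_le_right _ _)
    rw [hzw] at h1'
    have := dist_triangle_left (D.pt 0) (D.pt 1) p.2
    linarith
  have H2 := hK2 D D' hsub φ A hA Φ p.1 p.2 hz hw hne
  have ev4 := Metric.tendsto_nhds.1 H2 _ he3
  filter_upwards [H1 p.1 p.2 hz hw hzr hwr, ev4] with δ hδ1 hδ2
  unfold ratio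
  rw [Real.dist_eq] at hδ2 h3 ⊢
  have t1 := abs_sub_le (T D'.carrier δ (a δ) (b δ) / T D.carrier δ (a δ) (b δ))
    (T D'.carrier δ (nearestSite δ p.1) (nearestSite δ p.2) /
      T D.carrier δ (nearestSite δ p.1) (nearestSite δ p.2)) (d ^ ((1 : ℝ) / 2))
  have t2 := abs_sub_le (T D'.carrier δ (nearestSite δ p.1) (nearestSite δ p.2) /
      T D.carrier δ (nearestSite δ p.1) (nearestSite δ p.2))
    (twoPointFreeCHI (fun x => Φ (φ.symm x)) p.1 p.2 / twoPointFreeCHI (fun x => φ.symm x) p.1 p.2)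
    (d ^ ((1 : ℝ) / 2))
  linarith

/-! ### Necessity of the registered stub (PROVED, cycle c1): modulo the bulk free ratio (the printed
fact X, through the landed `bulkFreeRatio_of_chi`) and boundary fusion (landed), the crux's normal
form IMPLIES `AnchorTransfer`. Together with `normalForm_of_transfer` this makes the one open lattice
stub crux-EQUIVALENT modulo print: `anchorTransfer_iff_normalForm`. -/

/-- `BulkFreeRatio → BoundaryFusion → NormalForm → AnchorTransfer`: produce conformal data
`(φ, A, Φ, d)` for the pair `D' ⊆ D` (chordal uniformizer, pulled-back `*`-hull, its restriction map
and derivative — all exist by tree theorems), read off from `BoundaryFusion` a radius `r` on which the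
continuum ratio is within `η/3` of `d^{1/2}`, and compare along `δ → 0⁺` the crux's ratio (→ `d^{1/2}`,
`NormalForm`) with the bulk lattice ratio at `(z, w)` (→ the continuum ratio, `BulkFreeRatio`). -/
theorem anchorTransfer_of_normalForm (hK2 : BulkFreeRatio) (hK3 : BoundaryFusion)
    (h : NormalForm) : AnchorTransfer := by
  intro D D' a b hD hD' hsub hε η hη
  obtain ⟨h0, h1⟩ := pt_eq_of_isEndpointApprox hD hD'
  -- conformal data for the pair `D' ⊆ D`
  obtain ⟨φ, hφ⟩ := MarkedDomain.exists_isChordalUniformizing_holds D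
  set A : Set ℂ := closure (upperHalfPlaneSet \ {z | z ∈ upperHalfPlaneSet ∧ φ z ∈ D'.carrier})
    with hA
  have hHull : D.IsHullSubdomain D' := isHullSubdomain_of_conds hsub h0 h1 hε
  have hstar : IsStarHull A := by
    rw [hA]
    exact IsStarHull.pullbackHull JordanDomain.isSimplyConnected_holds hφ hHull
  obtain ⟨Φ, hΦ, -⟩ := IsStarHull.existsUnique_isRestrictionMap_holds hstar
  obtain ⟨d, -, -, hd⟩ := IsStarHull.exists_hasRestrictionDeriv_holds hstar hΦ
  have H := h D D' a b hD hD' hsub h0 h1 hε φ hφ A hA Φ d hΦ hd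
  have H3 := hK3 D D' hsub h0 h1 hε φ hφ A hA Φ d hΦ hd
  have he3 : 0 < η / 3 := by positivity
  -- a uniform radius from boundary fusion
  have ev3 := Metric.tendsto_nhds.1 H3 _ he3
  rw [Filter.eventually_prod_iff] at ev3
  obtain ⟨pa, hpa, pb, hpb, hp⟩ := ev3
  rw [eventually_nhdsWithin_iff, Metric.eventually_nhds_iff] at hpa hpb
  obtain ⟨ra, hra, Ha⟩ := hpa
  obtain ⟨rb, hrb, Hb⟩ := hpb
  have hab : D.pt 0 ≠ D.pt 1 := fun h => absurd (D.pt_injective h) (by decide)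
  set L := dist (D.pt 0) (D.pt 1) with hLdef
  have hL0 : 0 < L := dist_pos.2 hab
  refine ⟨min (min ra rb) (L / 2), lt_min (lt_min hra hrb) (half_pos hL0), ?_⟩
  intro z w hz hw hzr hwr
  have hza : dist z (D.pt 0) < ra := lt_of_lt_of_le hzr ((min_le_left _ _).trans (min_le_left _ _))
  have hwb : dist w (D.pt 1) < rb := lt_of_lt_of_le hwr ((min_le_left _ _).trans (min_le_right _ _))
  have hne : z ≠ w := by
    intro hzw
    have h1' : dist z (D.pt 0) < L / 2 := lt_of_lt_of_le hzr (min_le_right _ _)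
    have h2' : dist w (D.pt 1) < L / 2 := lt_of_lt_of_le hwr (min_le_right _ _)
    rw [hzw] at h1'
    have := dist_triangle_left (D.pt 0) (D.pt 1) w
    linarith
  have h3 : dist (twoPointFreeCHI (fun x => Φ (φ.symm x)) z w / twoPointFreeCHI (fun x => φ.symm x) z w)
      (d ^ ((1 : ℝ) / 2)) < η / 3 := hp (Ha hza hz) (Hb hwb hw)
  have H2 := hK2 D D' hsub φ A hA Φ z w hz hw hne
  have ev4 := Metric.tendsto_nhds.1 H2 _ he3
  have evQ := Metric.tendsto_nhds.1 H _ he3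
  filter_upwards [ev4, evQ] with δ h4 hQ
  unfold ratio at hQ
  rw [Real.dist_eq] at h3 h4 hQ
  rw [abs_sub_comm] at h4
  have t1 := abs_sub_le (T D'.carrier δ (a δ) (b δ) / T D.carrier δ (a δ) (b δ)) (d ^ ((1 : ℝ) / 2))
    (T D'.carrier δ (nearestSite δ z) (nearestSite δ w) / T D.carrier δ (nearestSite δ z) (nearestSite δ w))
  have t2 := abs_sub_le (d ^ ((1 : ℝ) / 2))
    (twoPointFreeCHI (fun x => Φ (φ.symm x)) z w / twoPointFreeCHI (fun x => φ.symm x) z w)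
    (T D'.carrier δ (nearestSite δ z) (nearestSite δ w) / T D.carrier δ (nearestSite δ z) (nearestSite δ w))
  rw [abs_sub_comm] at h3
  linarith

/-- **The residual stub is crux-equivalent modulo print**: given the bulk free ratio (X) and boundary
fusion (landed), `AnchorTransfer ↔ NormalForm` (`↔ IsingBoundaryRatio` by the landed
`isingBoundaryRatio_iff_normalForm`). -/
theorem anchorTransfer_iff_normalForm (hK2 : BulkFreeRatio) (hK3 : BoundaryFusion) :
    AnchorTransfer ↔ NormalForm :=
  ⟨fun h => normalForm_of_transfer h hK2 hK3, anchorTransfer_of_normalForm hK2 hK3⟩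

/-! ### Name-keyed aliases of the open statements (the hypotheses of the composition: the skeleton
audit admits a hypothesis only if its head constant is a registered obligation or is named like a
declared stub; the stub attribute itself is gate-reserved) -/
namespace Registered

/-- Alias of `AnchorTransfer` keyed by the registered stub name (rev 4). -/
abbrev stub_anchorTransfer : Prop := AnchorTransfer
/-- Alias of the named fact X keyed by the registered stub name. -/
abbrev stub_chiTwoPointFreeJordan : Prop := Literature.Probability.LatticeModels.chi_twoPoint_free_jordan

end Registered

/-! ### The composition: the two open stubs ⇒ the crux BY NAME (kernel-checked, no `sorry`) -/

/-- **`IsingBoundaryRatio_of`** (rev 4): anchor transfer (stub 1, open) + the named fact X =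
`chi_twoPoint_free_jordan` (CHI15 Thm 1.1 free) ⇒ `IsingBoundaryRatio`, through the LANDED stubs
(`bulkFreeRatio_of_chi` p91239, `stub_restrictionMapAtZero` p86712, `stub_restrictionMapAtInfty`
p88223, `stub_boundaryFusionCore` p87614), the proved `normalForm_of_transfer`, and the landed
equivalence `isingBoundaryRatio_iff_normalForm` (crux ⟺ its `T`-normal form). -/
theorem IsingBoundaryRatio_of (h1 : Registered.stub_anchorTransfer)
    (hX : Registered.stub_chiTwoPointFreeJordan) : Theses.SAWLoopFugacityFlow.IsingBoundaryRatio :=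
  isingBoundaryRatio_iff_normalForm.2
    (normalForm_of_transfer h1
      (Summit.CriticalPhenomena.SAWScalingLimit.Theorems.IsingBoundaryRatio.bulkFreeRatio_of_chi hX)
      (stub_boundaryFusionCore stub_restrictionMapAtZero
        (stub_restrictionMapAtInfty stub_restrictionMapAtZero)))

/-- The rev-3 entry still closes the line: anchor LOCALITY (one marked point at a time) gives the
registered stub (`anchorTransfer_of_anchorLocality`), hence with X the crux via `IsingBoundaryRatio_of`. -/
theorem stub_anchorTransfer_of_anchorLocality (hL : AnchorLocality) : Registered.stub_anchorTransfer :=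
  anchorTransfer_of_anchorLocality hL

/-- Conversely (cycle c1): modulo X the crux IMPLIES the registered stub — `stub_anchorTransfer` is
exactly the unprinted content of `IsingBoundaryRatio`. -/
theorem anchorTransfer_of_IsingBoundaryRatio (hX : Registered.stub_chiTwoPointFreeJordan)
    (h : Theses.SAWLoopFugacityFlow.IsingBoundaryRatio) : AnchorTransfer :=
  anchorTransfer_of_normalForm
    (Summit.CriticalPhenomena.SAWScalingLimit.Theorems.IsingBoundaryRatio.bulkFreeRatio_of_chi hX)
    (stub_boundaryFusionCore stub_restrictionMapAtZero
      (stub_restrictionMapAtInfty stub_restrictionMapAtZero))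
    (isingBoundaryRatio_iff_normalForm.1 h)

/-- Wiring check: the two `sorry`'d stubs feed `IsingBoundaryRatio_of` as stated. -/
example : Theses.SAWLoopFugacityFlow.IsingBoundaryRatio :=
  IsingBoundaryRatio_of stub_anchorTransfer stub_chiTwoPointFreeJordan


end Summit.CriticalPhenomena.SAWScalingLimit.Cruxes.IsingBoundaryRatio.FkAnchorTransfer

end
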